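import Summits.Ventures.AbcSig.Rows.Statements
import Summits.Ventures.AbcSig.Rows.XnYn37Z2EvenX

/-!
# Venture AbcSig — CELL bridge for `xⁿ + yⁿ = 37 z²`, `xy` even: p1's census predicate `Rows.C1CellEven 37 11 ∅`

HONEST FRAMING. COMPUTATION cell `pub-abcsig`; CONDITIONAL theorem; no claim on ABC or any summit. Hypotheses exactly
those of `Rows/XnYn37Z2EvenX.lean` (`xrow_XnYn37Z2Even`): `BS04Package` (CITED), `EisChiPackage` (CITED), `DataComplete` /
`Refines` (COMPUTED, certified level files), and the row's per-orbit CITED exclusions `hX_…` universally quantified in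
the exponent. Conclusion = the census statement of the SIGNED row of record `census/rows/C1/C1-C37-even.md` in p1's
vocabulary (`Rows/Statements.lean`): every prime `n ≥ 11`, `n ∤ 37`, no primitive solution with `xy` even.
GENERATED by p-lean gen3/make_c1cell.py (pattern of `Rows/BridgeC1P2.lean`).
-/

namespace Summit.Ventures.AbcSig

/-- `xⁿ + yⁿ = 37z²`, `xy` even, every prime `n ≥ 11` with `n ∤ 37`: p1's `Rows.C1CellEven 37 11 ∅` from `xrow_XnYn37Z2Even`. -/
theorem C1CellEven_37_of (M : NewformModel) (hP : M.BS04Package)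
    (hEχ : M.EisChiPackage)
    (hK11 : M.RefinedTraces (fun S => S.A = 1 ∧ S.B = 1 ∧ S.C = 37 ∧ S.n = 11 ∧ 2 ∣ S.a * S.b) krausTab_C37e_n11)
    (hD2738 : M.DataComplete 2738 level2738Orbits)
    (hRk_orbit_2738_9 : M.Refines 2738 orbit_2738_9 m4kX_2738_9)
    (hRk_orbit_2738_10 : M.Refines 2738 orbit_2738_10 m4kX_2738_10)
    (hRc_orbit_2738_12 : M.Refines 2738 orbit_2738_12 m6chiX_2738_12) :
    Rows.C1CellEven 37 11 ∅ :=
  fun n hn h11 hC _ x y z hpar =>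
    xrow_XnYn37Z2Even M hP hEχ hK11 hD2738 hRk_orbit_2738_9 hRk_orbit_2738_10 hRc_orbit_2738_12 n hn h11 (by
      intro hmem
      simp only [List.mem_cons, List.not_mem_nil, or_false] at hmem
      subst hmem
      exact hC (by norm_num)) x y z hpar

end Summit.Ventures.AbcSig
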